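import Summits.BirchSwinnertonDyer.BirchSwinnertonDyer.Theorems.DerivedCoinvariantProfileAtPoint
import Literature.NumberTheory.EllipticCurves.IwasawaLeadingTerm
import Literature.NumberTheory.EllipticCurves.IwasawaLeadingTermProofs
import Literature.NumberTheory.EllipticCurves.CanonicalPAdicHeightHolds
import Literature.NumberTheory.EllipticCurves.SelmerCorankControlRatOrdinaryProofs
import Literature.NumberTheory.EllipticCurves.CyclotomicIwasawaMainTheoremIrreducible
import Literature.NumberTheory.EllipticCurves.PAdicLFunctionOrderTransferRankOneProofs
import Literature.NumberTheory.EllipticCurves.KatoRankBoundProofs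
import HarnessLib

/-!
# The derived coinvariant profile against Schneider's theorem: `e_2(X(E/ℚ_∞)) = 0 ⟺ Reg_p(E) ≠ 0`,
# the quantified excess `ord_{T=0} f_E − rank = corank Ш[p^∞] + ∑_{i≥2} e_i`, the rank-two jump
# `Reg_p(E) = 0 ⟹ T⁴ ∣ f_E`, transferred to `L_p(E,T)` on the Burungale–Castella–Skinner locus

Cell `bsd-rank2`, seat p2 (planner), GEN 70, kernel file K70-B; companion of `DerivedCoinvariantProfile`,
`DerivedCoinvariantProfileAtPoint` (GEN 69) and `DerivedCoinvariantProfileDischarged` (K70-A). PURPOSE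
[rank2-p2]: "the exact extra input that turns the inequality into equality on an infinite class … the
equality door typed via the kernel theorems". K69/K70-A typed the door STRUCTURALLY — under (MC_T),
`ord_{T=0} L_p(E,T) = rank E(ℚ) ⟺ e_2(X(E/ℚ_∞)) = 0 ∧ corank_{ℤ_p} Ш(E/ℚ)[p^∞] = 0`, with
`e_{i+1}(X) = derivedLength p X i` the `(T)`-length of `T^i X/T^{i+1} X` (`e_1 = rank_{ℤ_p} X/TX`,
non-increasing, `ℓ_{(T)}(X) = ∑_{i≥1} e_i`). The tree also holds the door IN PRINT CURRENCY: the named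
fact `Schneider1985_order_charGenerator` =: PRS (Perrin-Riou–Schneider as printed in
Balakrishnan–Müller–Stein, Math. Comp. 85 (2016), Thm. 1.7): `ord_{T=0} f_E = rank ⟺ Reg_p(E) ≠ 0 ∧
Ш(E/ℚ)[p^∞]` finite (`f_E` a characteristic series of `X(E/ℚ_∞)`, `p ≥ 5` good ordinary, canonical
height). This file IDENTIFIES the two doors and reads off what the identification adds.

§1 (currency `f_E`): `order_charGenerator_eq_rank_add_shaCorank_add_sum_derivedLength` — for EVERY `E`,
every good ordinary `p`, NO print fact: `ord_{T=0} f_E = rank + corank Ш[p^∞] + ∑_{i≥2} e_i(X)` (the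
quantified form of PRS clause 1 `rank ≤ ord f_E`); `order_charGenerator_eq_rank_iff` — the structural
door; `derivedLength_one_eq_zero_and_shaCorank_eq_zero_iff_schneider` (PRS) — THE DICTIONARY
`(e_2 = 0 ∧ corank Ш[p^∞] = 0) ⟺ (Reg_p ≠ 0 ∧ Ш[p^∞] finite)`, whence for `Ш[p^∞]` finite
**`e_2(X(E/ℚ_∞)) = 0 ⟺ SchneiderConjecture`** and `Reg_p ≠ 0 ⟺ e_i = 0 ∀ i ≥ 2` — the expected
"Schneider's height = the first derived height, `dim S_p^{(2)} = e_2`" [Howard2004DerivedHeights,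
Cor. 5.3; BertoliniDarmon1995, §2], obtained WITHOUT constructing any height, from the two order
formulas; `four_le_order_charGenerator_of_not_schneiderConjecture` (PRS + Howard's parity constraint at
`r = 2` as a HYPOTHESIS, as in K69 §6) — THE RANK-TWO JUMP: rank `2`, `Ш[p^∞]` finite, `Reg_p(E) = 0`
`⟹ 4 ≤ ord_{T=0} f_E` (`T⁴ ∣ f_E`; print, `Schneider1985_order_charGenerator.X_pow_succ_dvd_of_not`,
gives `T³`).
§2 (currency `L_p(E,T)`, BCS LOCUS `p ≥ 5` good ordinary, `E[p]` irreducible, NO auxiliary prime;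
hypothesis the named fact `burungale_castella_skinner_charIdeal_eq_padicLFunction` =: BCS): a characteristic
series `g` with `ord_T g = ord_T L_p`; the exact identity `ord_{T=0} L_p = rank + corank Ш[p^∞] + ∑_{i≥2} e_i` and the structural door on
this locus (K70-A: Skinner–Urban locus); with PRS the print-key door (cf. the tree's
`order_padicLFunction_eq_rank_iff_finite_sha`, which assumes `Reg_p ≠ 0`) and the rank-two jump
`Reg_p = 0 ⟹ 4 ≤ ord_{T=0} L_p` for rank-2 curves with `Ш[p^∞]` finite. §3 datum-free headline forms.

BARRIER-B1 HONESTY. On the infinite class {(E,p) : p ≥ 5 good ordinary, E[p] irreducible}, granting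
exactly PRS and BCS, `rank ≤ ord_{T=0} L_p(E,T)` is an equality iff `Reg_p(E) ≠ 0 ∧ Ш(E/ℚ)[p^∞]` finite,
and the excess is EXACTLY `corank Ш[p^∞] + ∑_{i≥2} e_i(X(E/ℚ_∞))`, `e_2 = 0 ⟺ Reg_p ≠ 0` once `Ш[p^∞]` is
finite. Both keys are catalogued barriers at rank `≥ 2` (B1 = `Literature/Barriers/…/SelmerVersusMordellWeil`;
Schneider's conjecture = `Literature/Barriers/…/PAdicHeightNondegeneracy`; Howard: "it is not known
that `e_i = 0` for `i > 1`"); per curve both are decidable by finite computation (`p`-descent, a `p`-adic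
regulator), the rank-2 atlas' currency. NO motion on S0 is claimed; BSD is proved for no curve here.

References: BMS 2016 Thm. 1.7; Schneider 1985 Thm. 2′; BCS 2025 Thm. 1.1.2 (a); Howard 2004 Thm. 5.2,
Cor. 5.3; Bertolini–Darmon 1995 §2; Greenberg LNM 1716 Thm. 1.2, §1 p. 65; MST 2006 Conj. 1.1; Kato Thm. 17.4.
-/

-- D-0017: single-problem summit: `Summit.BirchSwinnertonDyer.BirchSwinnertonDyer.…` repeats a namespace BY DESIGN.
set_option linter.dupNamespace false

noncomputable section
open scoped BigOperators
namespace Summit.BirchSwinnertonDyer.BirchSwinnertonDyer.Theorems.DerivedCoinvariantProfileSchneider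

open Literature.NumberTheory.EllipticCurves Literature.NumberTheory.EllipticCurves.IwasawaAlgebra
  Literature.NumberTheory.EllipticCurves.ModularForms
open Summit.BirchSwinnertonDyer.BirchSwinnertonDyer.Theorems.DerivedCoinvariantProfile
  Summit.BirchSwinnertonDyer.BirchSwinnertonDyer.Theorems.DerivedCoinvariantProfileAtPoint
open scoped MatrixGroups ModularForm
open CongruenceSubgroup WeierstrassCurve

variable (p : ℕ) [Fact p.Prime] (W : WeierstrassCurve ℚ) [W.IsElliptic] [W.IsGloballyMinimal]
  {N : ℕ} [NeZero N] (f : CuspForm (Gamma0 N) 2)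
  {κ : ZpExtension ℚ p} {γ : Field.absoluteGaloisGroup ℚ}

/-! ## §1 Currency `f_E`: the quantified Schneider clause, the door, the dictionary, the rank-2 jump -/

omit [W.IsElliptic] [W.IsGloballyMinimal] in
/-- `ord_{T=0} f_E = ℓ_{(T)}(X)` for a characteristic power series `f_E` of the finitely generated
torsion module `X = X(E/K_∞)` (structure theorem; tree `IwasawaAlgebra.order_eq_toNat_lengthAt`).
[cite: GreenbergLNM1716, §1 p. 65] -/
theorem order_charGenerator_eq_lengthAt (D : W.SelmerDualData κ γ)
    [Module.Finite (IwasawaAlgebra p) D.X] (htors : D.IsTorsion)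
    {fE : IwasawaAlgebra p} (hfE : D.charIdeal = Ideal.span {fE}) :
    fE.order = Module.lengthAt (IwasawaAlgebra p) D.X (primeT p) := by
  rw [order_eq_toNat_lengthAt p htors fE hfE (primeT p) (primeT_asIdeal p),
    ENat.coe_toNat (lengthAt_primeT_ne_top D.X htors)]

/-- **Quantified Schneider, clause 1 (no print fact).** For every `E/ℚ` (globally minimal `W`), every
good ordinary `p`, the cyclotomic `ℤ_p`-extension `κ` with ANY topological generator `γ`, `X = X(E/ℚ_∞)`
torsion with characteristic power series `f_E`: for all `n ≫ 0`,
`ord_{T=0} f_E = rank E(ℚ) + corank_{ℤ_p} Ш(E/ℚ)[p^∞] + ∑_{1 ≤ i ≤ n} e_{i+1}(X)` and `e_{n+2}(X) = 0`.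
Inputs: the profile law `ℓ_{(T)}(X) = ∑ e_i` (GEN 69), Mazur control
`rank_{ℤ_p} X/TX = corank Sel_{p^∞}(E/ℚ)` (tree theorem `Greenberg1999_coinvariantsRank_eq_selmerCorank_rat_holds`)
and the Kummer identity `corank Sel = rank + corank Ш`. Print states only `rank ≤ ord f_E`
(BMS Thm. 1.7, clause 1). [cite: BalakrishnanMullerStein2015, Thm. 1.7] [cite: GreenbergLNM1716, Thm. 1.2 and §1 p. 65]
[cite: BertoliniDarmon1995, §2] [cite: Howard2004DerivedHeights, Thm. 5.2] -/
theorem order_charGenerator_eq_rank_add_shaCorank_add_sum_derivedLength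
    (hgood : W.HasGoodReductionAtPrime p) (hord : ¬ (p : ℤ) ∣ W.frobeniusTrace p)
    (hκ : κ.IsCyclotomic) (hγ : κ.IsTopGenerator γ) (D : W.SelmerDualData κ γ)
    (htors : D.IsTorsion) {fE : IwasawaAlgebra p} (hfE : D.charIdeal = Ideal.span {fE}) :
    ∃ n₀ : ℕ, ∀ n, n₀ ≤ n →
      fE.order = (W.mordellWeilRank : ℕ∞) + W.shaCorank p +
          ∑ i ∈ Finset.Ico 1 (n + 1), derivedLength p D.X i ∧
        derivedLength p D.X (n + 1) = 0 := by
  haveI : Module.Finite (IwasawaAlgebra p) D.X := D.module_finite_of_isCyclotomic W κ hκ hγ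
  have hctrl : coinvariantsRank p D.X = W.selmerCorank p :=
    (Greenberg1999_coinvariantsRank_eq_selmerCorank_rat_holds W p hgood hord κ γ hκ hγ D).2
  have hid : W.selmerCorank p = W.mordellWeilRank + W.shaCorank p :=
    W.selmerCorank_eq_mordellWeilRank_add_holds p
  obtain ⟨n₀, h⟩ := exists_lengthAt_eq_sum_derivedLength p D.X htors
  refine ⟨n₀, fun n hn ↦ ?_⟩
  obtain ⟨hsum, hzero⟩ := h (n + 1) (by omega)
  refine ⟨?_, hzero⟩
  rw [order_charGenerator_eq_lengthAt p W D htors hfE, hsum, Finset.range_eq_Ico,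
    Finset.sum_eq_sum_Ico_succ_bot (Nat.succ_pos n), derivedLength_zero_eq_coinvariantsRank, hctrl,
    hid, Nat.cast_add]

/-- **The structural door in currency `f_E` (no print fact).** Same setting:
`ord_{T=0} f_E = rank E(ℚ) ⟺ e_2(X(E/ℚ_∞)) = 0 ∧ corank_{ℤ_p} Ш(E/ℚ)[p^∞] = 0`.
[cite: GreenbergLNM1716, §1 p. 65] [cite: BertoliniDarmon1995, §2] -/
theorem order_charGenerator_eq_rank_iff
    (hgood : W.HasGoodReductionAtPrime p) (hord : ¬ (p : ℤ) ∣ W.frobeniusTrace p)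
    (hκ : κ.IsCyclotomic) (hγ : κ.IsTopGenerator γ) (D : W.SelmerDualData κ γ)
    (htors : D.IsTorsion) {fE : IwasawaAlgebra p} (hfE : D.charIdeal = Ideal.span {fE}) :
    fE.order = W.mordellWeilRank ↔ derivedLength p D.X 1 = 0 ∧ W.shaCorank p = 0 := by
  haveI : Module.Finite (IwasawaAlgebra p) D.X := D.module_finite_of_isCyclotomic W κ hκ hγ
  have hctrl : coinvariantsRank p D.X = W.selmerCorank p :=
    (Greenberg1999_coinvariantsRank_eq_selmerCorank_rat_holds W p hgood hord κ γ hκ hγ D).2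
  have hid : W.selmerCorank p = W.mordellWeilRank + W.shaCorank p :=
    W.selmerCorank_eq_mordellWeilRank_add_holds p
  have hcrit := lengthAt_eq_coinvariantsRank_iff_derivedLength_one_eq_zero p D.X htors
  have hc1 : (coinvariantsRank p D.X : ℕ∞) ≤ Module.lengthAt (IwasawaAlgebra p) D.X (primeT p) :=
    coinvariantsRank_le_lengthAt_primeT D.X
  rw [order_charGenerator_eq_lengthAt p W D htors hfE]
  obtain ⟨ℓ, hℓ⟩ := ENat.ne_top_iff_exists.mp (lengthAt_primeT_ne_top D.X htors)
  rw [← hℓ] at hc1 hcrit ⊢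
  rw [hctrl, hid] at hc1 hcrit
  have hc1' : W.mordellWeilRank + W.shaCorank p ≤ ℓ := by exact_mod_cast hc1
  constructor
  · intro h
    have h' : ℓ = W.mordellWeilRank := by exact_mod_cast h
    have hsha : W.shaCorank p = 0 := by omega
    exact ⟨hcrit.mp (by exact_mod_cast (show ℓ = W.mordellWeilRank + W.shaCorank p by omega)), hsha⟩
  · rintro ⟨h1, hsha⟩
    have h := hcrit.mpr h1
    rw [h, hsha, Nat.add_zero]

/-- **THE DICTIONARY.** Granting the named fact `Schneider1985_order_charGenerator` (PRS, BMS
Thm. 1.7 clause 2: `ord_{T=0} f_E = rank ⟺ Reg_p ≠ 0 ∧ Ш[p^∞]` finite), for `p ≥ 5` good ordinary, the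
cyclotomic datum with normalised generator, `X(E/ℚ_∞)` torsion with characteristic series `f_E` and the
canonical height `Dh`:
`(e_2(X(E/ℚ_∞)) = 0 ∧ corank_{ℤ_p} Ш(E/ℚ)[p^∞] = 0) ⟺ (SchneiderConjecture Dh ∧ Ш(E/ℚ)[p^∞] finite)`.
The structural door (`order_charGenerator_eq_rank_iff`, kernel) and the print door open together.
CONDITIONAL on PRS. [cite: BalakrishnanMullerStein2015, Thm. 1.7] [cite: Schneider1985, Thm. 2′ (p. 342)]
[cite: Howard2004DerivedHeights, Cor. 5.3] -/
theorem derivedLength_one_eq_zero_and_shaCorank_eq_zero_iff_schneider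
    (h85 : Schneider1985_order_charGenerator) (hp : 5 ≤ p)
    (hgood : W.HasGoodReductionAtPrime p) (hord : ¬ (p : ℤ) ∣ W.frobeniusTrace p)
    (hκ : κ.IsCyclotomic) (hγ : κ.IsTopGenerator γ) (hγ' : IsCyclotomicVariable p γ)
    (D : W.SelmerDualData κ γ) (htors : D.IsTorsion)
    {fE : IwasawaAlgebra p} (hfE : D.charIdeal = Ideal.span {fE})
    {Dh : PAdicHeightData W p} (hDh : Dh.IsCanonical) :
    (derivedLength p D.X 1 = 0 ∧ W.shaCorank p = 0) ↔
      (SchneiderConjecture Dh ∧ Finite (AddCommGroup.primaryComponent W.sha p)) := by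
  haveI : Module.Finite (IwasawaAlgebra p) D.X := D.module_finite_of_isCyclotomic W κ hκ hγ
  rw [← order_charGenerator_eq_rank_iff p W hgood hord hκ hγ D htors hfE]
  exact (h85 W p hp hgood hord κ γ hκ hγ hγ' D htors fE hfE Dh hDh).2.1

/-- **`e_2(X(E/ℚ_∞)) = 0 ⟺ Reg_p(E) ≠ 0`, for `Ш(E/ℚ)[p^∞]` finite.** Granting PRS: the second derived
coinvariant length of `X(E/ℚ_∞)` vanishes (`TX/T²X` finite; no Jordan block of `T` of length `≥ 2` at
`(T)`) iff the canonical cyclotomic `p`-adic height is non-degenerate — the kernel form of "the first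
derived height is Schneider's height and `dim S_p^{(2)} = e_2`" (Howard, Cor. 5.3), read off the two
order formulas. CONDITIONAL on PRS. [cite: BalakrishnanMullerStein2015, Thm. 1.7]
[cite: Howard2004DerivedHeights, Cor. 5.3] [cite: MazurSteinTate2006, Conj. 1.1] -/
theorem derivedLength_one_eq_zero_iff_schneiderConjecture
    (h85 : Schneider1985_order_charGenerator) (hp : 5 ≤ p)
    (hgood : W.HasGoodReductionAtPrime p) (hord : ¬ (p : ℤ) ∣ W.frobeniusTrace p)
    (hκ : κ.IsCyclotomic) (hγ : κ.IsTopGenerator γ) (hγ' : IsCyclotomicVariable p γ)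
    (D : W.SelmerDualData κ γ) (htors : D.IsTorsion)
    {fE : IwasawaAlgebra p} (hfE : D.charIdeal = Ideal.span {fE})
    {Dh : PAdicHeightData W p} (hDh : Dh.IsCanonical)
    (hfin : Finite (AddCommGroup.primaryComponent W.sha p)) :
    derivedLength p D.X 1 = 0 ↔ SchneiderConjecture Dh := by
  have h := derivedLength_one_eq_zero_and_shaCorank_eq_zero_iff_schneider p W h85 hp hgood hord hκ
    hγ hγ' D htors hfE hDh
  have hsha : W.shaCorank p = 0 := (finite_primaryComponent_sha_iff_shaCorank_eq_zero W p).mp hfin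
  exact ⟨fun h1 ↦ (h.mp ⟨h1, hsha⟩).1, fun hS ↦ (h.mpr ⟨hS, hfin⟩).1⟩

/-- **`Reg_p(E) ≠ 0 ⟺` the whole higher profile vanishes** (`e_i(X) = 0` for all `i ≥ 2`; `Ш[p^∞]` finite;
monotonicity `e_2 ≥ e_3 ≥ ⋯`). CONDITIONAL on PRS. [cite: BalakrishnanMullerStein2015, Thm. 1.7] [cite: Howard2004DerivedHeights, Cor. 5.3] -/
theorem forall_derivedLength_eq_zero_iff_schneiderConjecture
    (h85 : Schneider1985_order_charGenerator) (hp : 5 ≤ p)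
    (hgood : W.HasGoodReductionAtPrime p) (hord : ¬ (p : ℤ) ∣ W.frobeniusTrace p)
    (hκ : κ.IsCyclotomic) (hγ : κ.IsTopGenerator γ) (hγ' : IsCyclotomicVariable p γ)
    (D : W.SelmerDualData κ γ) (htors : D.IsTorsion)
    {fE : IwasawaAlgebra p} (hfE : D.charIdeal = Ideal.span {fE})
    {Dh : PAdicHeightData W p} (hDh : Dh.IsCanonical)
    (hfin : Finite (AddCommGroup.primaryComponent W.sha p)) :
    (∀ i, 1 ≤ i → derivedLength p D.X i = 0) ↔ SchneiderConjecture Dh := by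
  rw [← derivedLength_one_eq_zero_iff_schneiderConjecture p W h85 hp hgood hord hκ hγ hγ' D htors hfE
    hDh hfin]
  exact ⟨fun h ↦ h 1 le_rfl, fun h1 i hi ↦ derivedLength_eq_zero_of_eq_zero p hi h1⟩

/-- **Corank-2 dichotomy in currency `f_E` (no print fact; Howard parity as HYPOTHESIS).** If
`corank Sel_{p^∞}(E/ℚ) = 2` and `X(E/ℚ_∞)` has an even number of blocks `Λ/(T²)` at `(T)` (`hH`, the
case `r = 2` of Howard's parity constraint, Cor. 5.3 — NOT proved here), then `ord_{T=0} f_E = 2` or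
`ord_{T=0} f_E ≥ 4`. [cite: Howard2004DerivedHeights, Cor. 5.3] [cite: GreenbergLNM1716, Thm. 1.2] -/
theorem order_charGenerator_eq_two_or_four_le_of_even_blocks_two
    (hgood : W.HasGoodReductionAtPrime p) (hord : ¬ (p : ℤ) ∣ W.frobeniusTrace p)
    (hκ : κ.IsCyclotomic) (hγ : κ.IsTopGenerator γ) (D : W.SelmerDualData κ γ)
    (htors : D.IsTorsion) {fE : IwasawaAlgebra p} (hfE : D.charIdeal = Ideal.span {fE})
    (hH : ∃ m : ℕ, derivedLength p D.X 1 = derivedLength p D.X 2 + 2 * (m : ℕ∞))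
    (hs : W.selmerCorank p = 2) :
    fE.order = 2 ∨ 4 ≤ fE.order := by
  haveI : Module.Finite (IwasawaAlgebra p) D.X := D.module_finite_of_isCyclotomic W κ hκ hγ
  have hctrl : coinvariantsRank p D.X = W.selmerCorank p :=
    (Greenberg1999_coinvariantsRank_eq_selmerCorank_rat_holds W p hgood hord κ γ hκ hγ D).2
  have h2 : derivedLength p D.X 0 = 2 := by
    rw [derivedLength_zero_eq_coinvariantsRank, hctrl, hs, Nat.cast_ofNat]
  rw [order_charGenerator_eq_lengthAt p W D htors hfE]
  exact lengthAt_eq_two_or_four_le_of_even_blocks_two p D.X htors hH h2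

/-- **THE RANK-TWO JUMP.** Granting PRS and Howard's parity constraint at `r = 2` (hypothesis `hH`):
if `rank E(ℚ) = 2`, `Ш(E/ℚ)[p^∞]` is finite and the canonical `p`-adic height is DEGENERATE
(`Reg_p(E) = 0`), then `4 ≤ ord_{T=0} f_E`, i.e. `T⁴ ∣ f_E`. Print (PRS clauses 1–2,
`Schneider1985_order_charGenerator.X_pow_succ_dvd_of_not`) gives `T³ ∣ f_E`; the extra zero is the
parity of the alternating second derived height. CONDITIONAL on PRS (and `hH`).
[cite: BalakrishnanMullerStein2015, Thm. 1.7] [cite: Howard2004DerivedHeights, Thm. 5.2 and Cor. 5.3]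
[cite: BertoliniDarmon1995, §2] -/
theorem four_le_order_charGenerator_of_not_schneiderConjecture
    (h85 : Schneider1985_order_charGenerator) (hp : 5 ≤ p)
    (hgood : W.HasGoodReductionAtPrime p) (hord : ¬ (p : ℤ) ∣ W.frobeniusTrace p)
    (hκ : κ.IsCyclotomic) (hγ : κ.IsTopGenerator γ) (hγ' : IsCyclotomicVariable p γ)
    (D : W.SelmerDualData κ γ) (htors : D.IsTorsion)
    {fE : IwasawaAlgebra p} (hfE : D.charIdeal = Ideal.span {fE})
    {Dh : PAdicHeightData W p} (hDh : Dh.IsCanonical)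
    (hfin : Finite (AddCommGroup.primaryComponent W.sha p)) (hr : W.mordellWeilRank = 2)
    (hH : ∃ m : ℕ, derivedLength p D.X 1 = derivedLength p D.X 2 + 2 * (m : ℕ∞))
    (hReg : ¬ SchneiderConjecture Dh) :
    4 ≤ fE.order := by
  haveI : Module.Finite (IwasawaAlgebra p) D.X := D.module_finite_of_isCyclotomic W κ hκ hγ
  have hsha : W.shaCorank p = 0 := (finite_primaryComponent_sha_iff_shaCorank_eq_zero W p).mp hfin
  have hs : W.selmerCorank p = 2 := by
    have hid := W.selmerCorank_eq_mordellWeilRank_add_holds p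
    omega
  rcases order_charGenerator_eq_two_or_four_le_of_even_blocks_two p W hgood hord hκ hγ D htors hfE hH
      hs with h | h
  · exact absurd ((h85 W p hp hgood hord κ γ hκ hγ hγ' D htors fE hfE Dh hDh).2.1.mp
      (by rw [h, hr, Nat.cast_ofNat])).1 hReg
  · exact h

/-! ## §2 Currency `L_p(E,T)` on the Burungale–Castella–Skinner locus (`p ≥ 5` good ordinary, `E[p]` irreducible) -/

/-- **(MC_T) from BCS Thm. 1.1.2 (a)**: on the BCS locus `X(E/ℚ_∞)` is torsion with a characteristic
series `g` such that `ord_{T=0} L_p(E,T) = ord_{T=0} g` (`ι g = p^k · L_p`, order transfer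
`order_eq_order_of_iwasawaToPowerSeries_eq`). CONDITIONAL on BCS.
[cite: BurungaleCastellaSkinner2025, Thm. 1.1.2 (a) (p. 2 of arXiv:2405.00270v2)] -/
theorem isTorsion_and_exists_charGenerator_of_BCS
    (hBCS : burungale_castella_skinner_charIdeal_eq_padicLFunction) (hp : 5 ≤ p)
    (hgood : W.HasGoodReductionAtPrime p) (hord : ¬ (p : ℤ) ∣ W.frobeniusTrace p)
    (hirr : W.HasIrreducibleModPGaloisRep p) (hκ : κ.IsCyclotomic) (hγ : κ.IsTopGenerator γ)
    (hγ' : IsCyclotomicVariable p γ) (hf : IsNewformOf W f) (D : W.SelmerDualData κ γ) :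
    D.IsTorsion ∧ ∃ g : IwasawaAlgebra p, D.charIdeal = Ideal.span {g} ∧
      (padicLFunction f (unitRoot W p : ℚ_[p])).order = g.order := by
  obtain ⟨htors, g, k, hg, hιg⟩ := hBCS W p κ γ f hp hgood hord hirr hκ hγ hγ' hf D
  exact ⟨htors, g, hg, order_eq_order_of_iwasawaToPowerSeries_eq p hιg⟩

/-- **The exact identity on the BCS locus**: for every `E/ℚ`, every `p ≥ 5` good ordinary with `E[p]`
irreducible (no auxiliary multiplicative prime), for all `n ≫ 0`:
`ord_{T=0} L_p(E,T) = rank E(ℚ) + corank_{ℤ_p} Ш(E/ℚ)[p^∞] + ∑_{1 ≤ i ≤ n} e_{i+1}(X(E/ℚ_∞))`, `e_{n+2} = 0`.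
K70-A proved this on the Skinner–Urban locus; BCS removes the hypothesis (ram). CONDITIONAL on BCS.
[cite: BurungaleCastellaSkinner2025, Thm. 1.1.2 (a)] [cite: GreenbergLNM1716, Thm. 1.2]
[cite: BertoliniDarmon1995, §2] [cite: Howard2004DerivedHeights, Thm. 5.2] -/
theorem order_eq_rank_add_shaCorank_add_sum_derivedLength_of_BCS
    (hBCS : burungale_castella_skinner_charIdeal_eq_padicLFunction) (hp : 5 ≤ p)
    (hgood : W.HasGoodReductionAtPrime p) (hord : ¬ (p : ℤ) ∣ W.frobeniusTrace p)
    (hirr : W.HasIrreducibleModPGaloisRep p) (hκ : κ.IsCyclotomic) (hγ : κ.IsTopGenerator γ)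
    (hγ' : IsCyclotomicVariable p γ) (hf : IsNewformOf W f) (D : W.SelmerDualData κ γ) :
    ∃ n₀ : ℕ, ∀ n, n₀ ≤ n →
      (padicLFunction f (unitRoot W p : ℚ_[p])).order =
          (W.mordellWeilRank : ℕ∞) + W.shaCorank p +
            ∑ i ∈ Finset.Ico 1 (n + 1), derivedLength p D.X i ∧
        derivedLength p D.X (n + 1) = 0 := by
  obtain ⟨htors, g, hg, hLg⟩ :=
    isTorsion_and_exists_charGenerator_of_BCS p W f hBCS hp hgood hord hirr hκ hγ hγ' hf D
  rw [hLg]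
  exact order_charGenerator_eq_rank_add_shaCorank_add_sum_derivedLength p W hgood hord hκ hγ D htors hg

/-- **The structural door on the BCS locus**: `ord_{T=0} L_p(E,T) = rank ⟺ e_2(X(E/ℚ_∞)) = 0 ∧ corank Ш[p^∞] = 0`.
CONDITIONAL on BCS. [cite: BurungaleCastellaSkinner2025, Thm. 1.1.2 (a)] [cite: GreenbergLNM1716, Thm. 1.2 and §1 p. 65] -/
theorem order_eq_rank_iff_of_BCS
    (hBCS : burungale_castella_skinner_charIdeal_eq_padicLFunction) (hp : 5 ≤ p)
    (hgood : W.HasGoodReductionAtPrime p) (hord : ¬ (p : ℤ) ∣ W.frobeniusTrace p)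
    (hirr : W.HasIrreducibleModPGaloisRep p) (hκ : κ.IsCyclotomic) (hγ : κ.IsTopGenerator γ)
    (hγ' : IsCyclotomicVariable p γ) (hf : IsNewformOf W f) (D : W.SelmerDualData κ γ) :
    (padicLFunction f (unitRoot W p : ℚ_[p])).order = W.mordellWeilRank ↔
      derivedLength p D.X 1 = 0 ∧ W.shaCorank p = 0 := by
  obtain ⟨htors, g, hg, hLg⟩ :=
    isTorsion_and_exists_charGenerator_of_BCS p W f hBCS hp hgood hord hirr hκ hγ hγ' hf D
  rw [hLg]
  exact order_charGenerator_eq_rank_iff p W hgood hord hκ hγ D htors hg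

/-- **The print-key door on the BCS locus, both keys explicit**: granting PRS and BCS,
`ord_{T=0} L_p(E,T) = rank E(ℚ) ⟺ Reg_p(E) ≠ 0 ∧ Ш(E/ℚ)[p^∞]` finite (canonical height `Dh`). Cf. the
tree's `order_padicLFunction_eq_rank_iff_finite_sha` (same prints, `Reg_p ≠ 0` assumed).
CONDITIONAL on PRS, BCS. [cite: BalakrishnanMullerStein2015, Thm. 1.7] [cite: BurungaleCastellaSkinner2025, Thm. 1.1.2 (a)] -/
theorem order_eq_rank_iff_schneider_of_BCS
    (h85 : Schneider1985_order_charGenerator)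
    (hBCS : burungale_castella_skinner_charIdeal_eq_padicLFunction) (hp : 5 ≤ p)
    (hgood : W.HasGoodReductionAtPrime p) (hord : ¬ (p : ℤ) ∣ W.frobeniusTrace p)
    (hirr : W.HasIrreducibleModPGaloisRep p) (hκ : κ.IsCyclotomic) (hγ : κ.IsTopGenerator γ)
    (hγ' : IsCyclotomicVariable p γ) (hf : IsNewformOf W f) (D : W.SelmerDualData κ γ)
    {Dh : PAdicHeightData W p} (hDh : Dh.IsCanonical) :
    (padicLFunction f (unitRoot W p : ℚ_[p])).order = W.mordellWeilRank ↔
      (SchneiderConjecture Dh ∧ Finite (AddCommGroup.primaryComponent W.sha p)) := by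
  obtain ⟨htors, g, hg, hLg⟩ :=
    isTorsion_and_exists_charGenerator_of_BCS p W f hBCS hp hgood hord hirr hκ hγ hγ' hf D
  haveI : Module.Finite (IwasawaAlgebra p) D.X := D.module_finite_of_isCyclotomic W κ hκ hγ
  rw [hLg]
  exact (h85 W p hp hgood hord κ γ hκ hγ hγ' D htors g hg Dh hDh).2.1

/-- **The rank-two jump in currency `L_p` on the BCS locus**: granting PRS, BCS and Howard's parity
constraint at `r = 2` (hypothesis `hH`), a rank-2 curve with `Ш(E/ℚ)[p^∞]` finite and DEGENERATE
canonical `p`-adic height has `4 ≤ ord_{T=0} L_p(E,T)`. CONDITIONAL on PRS, BCS (and `hH`).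
[cite: BalakrishnanMullerStein2015, Thm. 1.7] [cite: BurungaleCastellaSkinner2025, Thm. 1.1.2 (a)]
[cite: Howard2004DerivedHeights, Cor. 5.3] -/
theorem four_le_order_of_BCS_of_not_schneiderConjecture
    (h85 : Schneider1985_order_charGenerator)
    (hBCS : burungale_castella_skinner_charIdeal_eq_padicLFunction) (hp : 5 ≤ p)
    (hgood : W.HasGoodReductionAtPrime p) (hord : ¬ (p : ℤ) ∣ W.frobeniusTrace p)
    (hirr : W.HasIrreducibleModPGaloisRep p) (hκ : κ.IsCyclotomic) (hγ : κ.IsTopGenerator γ)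
    (hγ' : IsCyclotomicVariable p γ) (hf : IsNewformOf W f) (D : W.SelmerDualData κ γ)
    {Dh : PAdicHeightData W p} (hDh : Dh.IsCanonical)
    (hfin : Finite (AddCommGroup.primaryComponent W.sha p)) (hr : W.mordellWeilRank = 2)
    (hH : ∃ m : ℕ, derivedLength p D.X 1 = derivedLength p D.X 2 + 2 * (m : ℕ∞))
    (hReg : ¬ SchneiderConjecture Dh) :
    4 ≤ (padicLFunction f (unitRoot W p : ℚ_[p])).order := by
  obtain ⟨htors, g, hg, hLg⟩ :=
    isTorsion_and_exists_charGenerator_of_BCS p W f hBCS hp hgood hord hirr hκ hγ hγ' hf D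
  rw [hLg]
  exact four_le_order_charGenerator_of_not_schneiderConjecture p W h85 hp hgood hord hκ hγ hγ' D htors
    hg hDh hfin hr hH hReg

/-! ## §3 Datum-free headline forms -/

/-- **Headline (dictionary).** Granting PRS and BCS: for every `E/ℚ`, `p ≥ 5` good ordinary with `E[p]`
irreducible and `Ш(E/ℚ)[p^∞]` finite, for the normalised cyclotomic datum and the canonical height:
`e_2(X(E/ℚ_∞)) = 0 ⟺ Reg_p(E) ≠ 0 ⟺ ord_{T=0} L_p(E,T) = rank E(ℚ)`. CONDITIONAL on PRS, BCS.
[cite: BalakrishnanMullerStein2015, Thm. 1.7] [cite: BurungaleCastellaSkinner2025, Thm. 1.1.2 (a)] [cite: Howard2004DerivedHeights, Cor. 5.3] -/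
theorem exists_datum_derivedLength_one_eq_zero_iff_schneider_iff_order_eq_rank
    (h85 : Schneider1985_order_charGenerator)
    (hBCS : burungale_castella_skinner_charIdeal_eq_padicLFunction) (hp : 5 ≤ p)
    (hgood : W.HasGoodReductionAtPrime p) (hord : ¬ (p : ℤ) ∣ W.frobeniusTrace p)
    (hirr : W.HasIrreducibleModPGaloisRep p) (hf : IsNewformOf W f)
    (hfin : Finite (AddCommGroup.primaryComponent W.sha p)) :
    ∃ (κ : ZpExtension ℚ p) (γ : Field.absoluteGaloisGroup ℚ) (D : W.SelmerDualData κ γ)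
      (Dh : PAdicHeightData W p), κ.IsCyclotomic ∧ κ.IsTopGenerator γ ∧ IsCyclotomicVariable p γ ∧
      Dh.IsCanonical ∧ D.IsTorsion ∧
      (derivedLength p D.X 1 = 0 ↔ SchneiderConjecture Dh) ∧
      (SchneiderConjecture Dh ↔
        (padicLFunction f (unitRoot W p : ℚ_[p])).order = W.mordellWeilRank) := by
  obtain ⟨κ, hκ, γ, hγ, hγ'⟩ := exists_isCyclotomic_isTopGenerator_isCyclotomicVariable_holds p
  obtain ⟨D⟩ := W.nonempty_selmerDualData_holds κ γ hγ
  obtain ⟨Dh, hDh⟩ := exists_isCanonical_holds W p hp hgood hord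
  obtain ⟨htors, g, hg, hLg⟩ :=
    isTorsion_and_exists_charGenerator_of_BCS p W f hBCS hp hgood hord hirr hκ hγ hγ' hf D
  refine ⟨κ, γ, D, Dh, hκ, hγ, hγ', hDh, htors,
    derivedLength_one_eq_zero_iff_schneiderConjecture p W h85 hp hgood hord hκ hγ hγ' D htors hg hDh
      hfin, ?_⟩
  have h := order_eq_rank_iff_schneider_of_BCS p W f h85 hBCS hp hgood hord hirr hκ hγ hγ' hf D hDh
  exact ⟨fun hS ↦ h.mpr ⟨hS, hfin⟩, fun ho ↦ (h.mp ho).1⟩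

/-- **Headline (rank-two jump).** Granting PRS, BCS and Howard's parity constraint at `r = 2` (`hH`, for
every cyclotomic datum): a rank-2 curve with `Ш(E/ℚ)[p^∞]` finite and DEGENERATE canonical height at a
prime `p ≥ 5` of good ordinary reduction with `E[p]` irreducible has `ord_{T=0} L_p(E,T) ≥ 4` (`p`-adic
BSD-rank fails at `p` by at least two). CONDITIONAL on PRS, BCS (and `hH`). [cite: BalakrishnanMullerStein2015, Thm. 1.7]
[cite: BurungaleCastellaSkinner2025, Thm. 1.1.2 (a)] [cite: Howard2004DerivedHeights, Cor. 5.3] -/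
theorem four_le_order_of_not_schneiderConjecture
    (h85 : Schneider1985_order_charGenerator)
    (hBCS : burungale_castella_skinner_charIdeal_eq_padicLFunction) (hp : 5 ≤ p)
    (hgood : W.HasGoodReductionAtPrime p) (hord : ¬ (p : ℤ) ∣ W.frobeniusTrace p)
    (hirr : W.HasIrreducibleModPGaloisRep p) (hf : IsNewformOf W f)
    (hfin : Finite (AddCommGroup.primaryComponent W.sha p)) (hr : W.mordellWeilRank = 2)
    (hH : ∀ (κ : ZpExtension ℚ p) (γ : Field.absoluteGaloisGroup ℚ) (D : W.SelmerDualData κ γ),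
      κ.IsCyclotomic → κ.IsTopGenerator γ →
        ∃ m : ℕ, derivedLength p D.X 1 = derivedLength p D.X 2 + 2 * (m : ℕ∞))
    (hReg : ∃ Dh : PAdicHeightData W p, Dh.IsCanonical ∧ ¬ SchneiderConjecture Dh) :
    4 ≤ (padicLFunction f (unitRoot W p : ℚ_[p])).order := by
  obtain ⟨κ, hκ, γ, hγ, hγ'⟩ := exists_isCyclotomic_isTopGenerator_isCyclotomicVariable_holds p
  obtain ⟨D⟩ := W.nonempty_selmerDualData_holds κ γ hγ
  obtain ⟨Dh, hDh, hReg⟩ := hReg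
  exact four_le_order_of_BCS_of_not_schneiderConjecture p W f h85 hBCS hp hgood hord hirr hκ hγ hγ' hf D
    hDh hfin hr (hH κ γ D hκ hγ) hReg

end Summit.BirchSwinnertonDyer.BirchSwinnertonDyer.Theorems.DerivedCoinvariantProfileSchneider
end
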